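import Mathlib.Tactic.DeriveFintype
import Literature.Computability.Complexity.TimeHierarchyDiagonal
import Literature.Computability.Complexity.FlatFuel
import HarnessLib

/-!
# The time hierarchy theorem: metering an unclocked interpreter gives a fuelled universal decider

Literature / complexity toolkit, second layer of the discharge of the named fact
`Literature.Computability.Complexity.time_hierarchy` (`TimeSpace.lean`, **pnp.S13**; Hartmanis–Stearns
1965, Thm. 9 / Cor. 9.1; Arora–Barak 2009, Thm. 3.1). The first layer
(`TimeHierarchyDiagonal.lean`) reduced the theorem to ONE machine, an inhabitant of the interface
`FuelledSimulator`: a `TM2` machine answering `sim x F` on the pair word `⟨x, 1^F⟩` in time LINEAR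
in `|x| + F`, universal with quadratic overhead and flipped answer. This file splits that machine
into its two textbook components (Arora–Barak 2009, §1.4.1: "a universal TM … by adding a time
counter to `𝒰`") and builds the time counter once and for all, so that what remains is an
UNCLOCKED interpreter verified on well-formed inputs only:

* the interpreter is any structured binary stack program `I : ACom Bool κ` (`SymbolPrograms.lean`)
  with an input register `X` and an answer register `ans`;
* **`FuelledRun.prog I X ans`** — the flat program (hence `TM2` machine, `AProg.aux`) on the
  registers `κ ⊕ Aux`: a prelude `FuelledRun.pre` parsing the input `⟨x, 1^F⟩` into `x` (on `X`) and
  the fuel `1^F` (on the clock register); the compiled interpreter METERED by the clock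
  (`FlatFuel.tick`: one fuel token per instruction, an empty clock exits); an epilogue
  `FuelledRun.epi` clearing every register and writing the bit `readout (ans)` (is the top of
  `ans` the symbol `1`?) on the output register;
* **`FuelledRun.run`** / **`FuelledRun.outputsWithin_machine`** — on EVERY input `⟨x, 1^F⟩` the
  machine halts within `(|κ| + 13)(|x| + F) + (|κ| + 13)` steps with output
  `[FuelledRun.sim I X ans x F]`, where `sim x F = readout` of register `ans` of the `F`-th iterate
  of the compiled interpreter from `⟨0, single X x⟩`. The point: whether the interpreter halts
  within the fuel (`FlatFuel.tick_complete`) or not (`FlatFuel.tick_exhaust`), the registers at the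
  exit ARE those of the `F`-th iterate (halted configurations are fixed), and their total size is at
  most `|x| + F` (`FuelledRun.total_iterate_le`: a flat step writes at most one symbol), which pays
  for the clean-up — so no property whatsoever of `I` on malformed inputs is needed;
* **`FuelledRun.sim_eq_of_runs`** — if `I` runs from `single X x` to `R'` within budget `≤ F`, then
  `sim x F = readout (R' ans)`;
* **`FuelledRun.fuelledSimulator`**, **`FuelledRun.time_hierarchy_of_interpreter`** — hence an
  interpreter which, for every machine `M`, admits a header `e` and a constant `κ₀` such that on
  `x = ⟨e, pad⟩` it reaches, within `κ₀ (t + |x|)² + κ₀` cost units, a store whose `ans` reads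
  `¬ b` whenever `M` outputs `b` on `x` within `t` steps (Arora–Barak 2009, Thm. 1.9, relaxed
  `C T²` form, for the tree's flat binary programs `TM2Flat.exists_aprogFin_of_outputsWithin`),
  yields a `FuelledSimulator` and therefore `time_hierarchy`.

## References

* S. Arora, B. Barak, *Computational Complexity: A Modern Approach*, CUP 2009, §1.4.1 ("Universal
  TM with time bound": the time counter), Thm. 1.9 (relaxed proof, `C T²`), Thm. 3.1 and its proof
  [AroraBarakCC2009]. doi:10.1017/cbo9780511804090
* J. Hartmanis, R. E. Stearns, *On the computational complexity of algorithms*, Trans. Amer.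
  Math. Soc. 117 (1965) 285–306, Thm. 9 / Cor. 9.1 [HartmanisStearns1965].
* T. Nipkow, G. Klein, *Concrete Semantics with Isabelle/HOL*, Springer 2014, §8.3 (placed code).
-/

namespace Literature.Computability.Complexity

open _root_.Computability Turing Function

namespace FuelledRun

open ACom

/-! ### Registers and stores -/

/-- The auxiliary registers around the interpreter's own: the machine's input register, a
scratch register of the prelude, the clock (fuel) register, the machine's output register.
[folklore] -/
inductive Aux
  | inp | tmp | clk | out
  deriving DecidableEq, Fintype

/-- The registers of the fuelled machine over an interpreter with registers `κ`. [folklore] -/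
abbrev Reg (κ : Type) : Type := κ ⊕ Aux

variable {κ : Type} [DecidableEq κ]

/-- The store with interpreter registers `R` and auxiliary registers `i, t, c, o`. [folklore] -/
def mk (R : AStore Bool κ) (i t c o : List Bool) : AStore Bool (Reg κ)
  | .inl k => R k
  | .inr .inp => i
  | .inr .tmp => t
  | .inr .clk => c
  | .inr .out => o

section MkLemmas

variable (R : AStore Bool κ) (i t c o v : List Bool)

omit [DecidableEq κ] in
/-- Read-out of an interpreter register. [folklore] -/
@[simp] theorem mk_inl (k : κ) : mk R i t c o (.inl k) = R k := rfl
omit [DecidableEq κ] in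
/-- Read-out of `inp`. [folklore] -/
@[simp] theorem mk_inp : mk R i t c o (.inr .inp) = i := rfl
omit [DecidableEq κ] in
/-- Read-out of `tmp`. [folklore] -/
@[simp] theorem mk_tmp : mk R i t c o (.inr .tmp) = t := rfl
omit [DecidableEq κ] in
/-- Read-out of `clk`. [folklore] -/
@[simp] theorem mk_clk : mk R i t c o (.inr .clk) = c := rfl
omit [DecidableEq κ] in
/-- Read-out of `out`. [folklore] -/
@[simp] theorem mk_out : mk R i t c o (.inr .out) = o := rfl

/-- Update of an interpreter register. [folklore] -/
@[simp] theorem update_mk_inl (k : κ) :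
    update (mk R i t c o) (.inl k) v = mk (update R k v) i t c o := by
  funext r
  rcases r with j | a
  · by_cases h : j = k
    · subst h; simp
    · rw [update_of_ne (by simpa using h)]; simp [update_of_ne h]
  · cases a <;> rfl
/-- Update of `inp`. [folklore] -/
@[simp] theorem update_mk_inp : update (mk R i t c o) (.inr .inp) v = mk R v t c o := by
  funext r; rcases r with j | a; · rfl
  cases a <;> rfl
/-- Update of `tmp`. [folklore] -/
@[simp] theorem update_mk_tmp : update (mk R i t c o) (.inr .tmp) v = mk R i v c o := by
  funext r; rcases r with j | a; · rfl
  cases a <;> rfl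
/-- Update of `clk`. [folklore] -/
@[simp] theorem update_mk_clk : update (mk R i t c o) (.inr .clk) v = mk R i t v o := by
  funext r; rcases r with j | a; · rfl
  cases a <;> rfl
/-- Update of `out`. [folklore] -/
@[simp] theorem update_mk_out : update (mk R i t c o) (.inr .out) v = mk R i t c v := by
  funext r; rcases r with j | a; · rfl
  cases a <;> rfl

end MkLemmas

/-- The machine's initial store. [folklore] -/
theorem single_inp (w : List Bool) :
    AStore.single (.inr .inp) w = mk (fun _ : κ => []) w [] [] [] := by
  funext r; rcases r with j | a
  · rfl
  · cases a <;> rfl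

/-- The machine's final store. [folklore] -/
theorem single_out (w : List Bool) :
    AStore.single (.inr .out) w = mk (fun _ : κ => []) [] [] [] w := by
  funext r; rcases r with j | a
  · rfl
  · cases a <;> rfl

/-- The ticked store of `FlatFuel` (interpreter registers grafted along `inl`, the clock on
`clk`) in terms of `mk`. [folklore] -/
theorem tstore_eq (S : AStore Bool (Reg κ)) (R : AStore Bool κ) (fuel : List Bool) :
    FlatFuel.tstore S Sum.inl (.inr .clk) R fuel =
      mk R (S (.inr .inp)) (S (.inr .tmp)) fuel (S (.inr .out)) := by
  funext r
  rcases r with k | a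
  · exact FlatFuel.tstore_apply_g Sum.inl_injective (fun _ => Sum.inl_ne_inr) S R fuel k
  · cases a
    · rw [FlatFuel.tstore, update_of_ne (by simp), graft_of_not _ _ _ (fun _ => Sum.inl_ne_inr)]; rfl
    · rw [FlatFuel.tstore, update_of_ne (by simp), graft_of_not _ _ _ (fun _ => Sum.inl_ne_inr)]; rfl
    · simp [mk]
    · rw [FlatFuel.tstore, update_of_ne (by simp), graft_of_not _ _ _ (fun _ => Sum.inl_ne_inr)]; rfl

/-! ### The prelude: `⟨x, 1^F⟩ ↦ (x, 1^F)` -/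

/-- The inner branch of the parser after popping `b` and then `o`: an equal pair is a bit of `x`
(collected, reversed, on `tmp`), an unequal pair is the separator (the rest is the fuel: pour it on
the clock), a missing partner ends the input. [folklore] -/
def preInner : Bool → Option Bool → ACom Bool (Reg κ)
  | true, some true => push (.inr .tmp) true
  | false, some false => push (.inr .tmp) false
  | _, some _ => pour (.inr .inp) (.inr .clk)
  | _, none => skip

/-- The body of the parser: pop the partner symbol and branch. [folklore] -/
def preBody (b : Bool) : ACom Bool (Reg κ) := pop (.inr .inp) (preInner b)

/-- The parser of pair words `⟨x, u⟩`: `x` reversed onto `tmp`, `u` reversed onto `clk`.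
[folklore] -/
def parse : ACom Bool (Reg κ) := loop (.inr .inp) preBody

/-- **The prelude**: parse, then pour `tmp` onto the interpreter's input register `X`.
[cite: AroraBarakCC2009, §1.4.1] -/
def pre (X : κ) : ACom Bool (Reg κ) := parse ;; pour (.inr .tmp) (.inl X)

/-- Effect and cost of `parse` on a pair word: `5 |x| + 3 |u| + 6` steps. [folklore] -/
theorem runs_parse (R : AStore Bool κ) (u : List Bool) : ∀ (x tacc : List Bool),
    Runs parse (mk R (boolPair x u) tacc [] []) (mk R [] (x.reverse ++ tacc) u.reverse [])
      (5 * x.length + 3 * u.length + 6)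
  | [], tacc => by
    have hin : boolPair [] u = false :: true :: u := rfl
    rw [hin]
    have hbody : Runs (preInner false (some true)) (mk R u tacc [] []) (mk R [] tacc u.reverse [])
        (3 * u.length + 1) := by
      have := runs_pour (Γ := Bool) (a := (Sum.inr Aux.inp : Reg κ)) (b := Sum.inr Aux.clk) (by simp)
        (mk R u tacc [] [])
      simpa [preInner] using this
    have hpop : Runs (preBody false) (mk R (true :: u) tacc [] []) (mk R [] tacc u.reverse [])
        (3 * u.length + 1 + 2) :=
      Runs.pop_cons' (f := preInner false) (k := (Sum.inr Aux.inp : Reg κ)) (a := true) (w := u)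
        (R := mk R (true :: u) tacc [] []) (R₀ := mk R u tacc [] []) rfl (by simp) hbody
    have h := Runs.loop_cons' (f := preBody) (k := (Sum.inr Aux.inp : Reg κ)) (a := false)
      (w := true :: u) (R := mk R (false :: true :: u) tacc [] []) (R₀ := mk R (true :: u) tacc [] [])
      rfl (by simp) hpop (Runs.loop_nil _ (R := mk R [] tacc u.reverse []) rfl)
    exact h.of_eq (by simp) (by omega)
  | b :: x, tacc => by
    have hin : boolPair (b :: x) u = b :: b :: boolPair x u := rfl
    have ih := runs_parse R u x (b :: tacc)
    rw [hin]
    have hbody : Runs (preInner b (some b)) (mk R (boolPair x u) tacc [] [])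
        (mk R (boolPair x u) (b :: tacc) [] []) 1 := by
      cases b <;> exact Runs.push' (by simp)
    have hpop := Runs.pop_cons' (f := preInner b) (k := (Sum.inr Aux.inp : Reg κ)) (a := b)
      (w := boolPair x u) (R := mk R (b :: boolPair x u) tacc [] []) (R₀ := mk R (boolPair x u) tacc [] [])
      rfl (by simp) hbody
    have h := Runs.loop_cons' (f := preBody) (k := (Sum.inr Aux.inp : Reg κ)) (a := b)
      (w := b :: boolPair x u) (R := mk R (b :: b :: boolPair x u) tacc [] [])
      (R₀ := mk R (b :: boolPair x u) tacc [] []) rfl (by simp) hpop ih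
    refine h.of_eq (by simp) ?_
    simp only [List.length_cons]
    omega

/-- **Effect and cost of the prelude** on the machine's input `⟨x, 1^F⟩`: `x` on `X`, the fuel on
the clock, everything else empty, within `8 |x| + 3 F + 7` steps. [cite: AroraBarakCC2009, §1.4.1] -/
theorem runs_pre (X : κ) (x : List Bool) (F : ℕ) :
    Runs (pre X) (AStore.single (.inr .inp) (boolPair x (List.replicate F true)))
      (mk (AStore.single X x) [] [] (List.replicate F true) []) (8 * x.length + 3 * F + 7) := by
  rw [single_inp]
  have h1 := runs_parse (κ := κ) (fun _ => []) (List.replicate F true) x []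
  have h2 := runs_pour (Γ := Bool) (a := (Sum.inr Aux.tmp : Reg κ)) (b := Sum.inl X) (by simp)
    (mk (fun _ : κ => []) [] (x.reverse ++ []) (List.replicate F true).reverse [])
  simp only [mk_tmp, mk_inl, List.append_nil, List.reverse_reverse, update_mk_tmp, update_mk_inl,
    List.length_reverse, List.reverse_replicate] at h2
  have e : update (fun _ : κ => ([] : List Bool)) X x = AStore.single X x :=
    (AStore.single_eq_update X x).symm
  rw [e] at h2
  simp only [List.append_nil, List.reverse_replicate] at h1
  exact (h1.seq h2).of_eq rfl (by simp; omega)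

/-! ### The epilogue: clean up and answer -/

/-- The answer read off a register content: is its top symbol `1`? [folklore] -/
def readout (w : List Bool) : Bool := decide (w.head? = some true)

/-- `readout (b :: w) = b`. [folklore] -/
@[simp] theorem readout_cons (b : Bool) (w : List Bool) : readout (b :: w) = b := by
  cases b <;> simp [readout]

/-- `readout [] = false`. [folklore] -/
@[simp] theorem readout_nil : readout [] = false := by simp [readout]

/-- Clear the listed interpreter registers. [folklore] -/
def clearRegs : List κ → ACom Bool (Reg κ)
  | [] => skip
  | k :: ks => clear (.inl k) ;; clearRegs ks

variable [Fintype κ]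

/-- The tail of the epilogue: clear all interpreter registers and write the answer bit.
[folklore] -/
noncomputable def epiTail (v : Bool) : ACom Bool (Reg κ) :=
  clearRegs (syms κ) ;; push (.inr .out) v

/-- **The epilogue**: clear the clock, pop the top of `ans` (deciding the answer), clear all
interpreter registers, write the answer. [cite: AroraBarakCC2009, Thm. 3.1 (proof: "output 1 - b, else output 0")] -/
noncomputable def epi (ans : κ) : ACom Bool (Reg κ) :=
  clear (.inr .clk) ;; pop (.inl ans) fun o => epiTail (decide (o = some true))

omit [Fintype κ] in
/-- Effect and cost of `clearRegs` on a duplicate-free list: the listed registers are emptied,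
at cost `Σ (2 |R k| + 1)`. [folklore] -/
theorem runs_clearRegs (i t c o : List Bool) : ∀ (ks : List κ), ks.Nodup → ∀ R : AStore Bool κ,
    Runs (clearRegs ks) (mk R i t c o) (mk (fun j => if j ∈ ks then [] else R j) i t c o)
      ((ks.map fun k => 2 * (R k).length + 1).sum)
  | [], _, R => by simpa [clearRegs] using Runs.skip (mk R i t c o)
  | k :: ks, hnd, R => by
    rw [List.nodup_cons] at hnd
    have h1 := runs_clear (Γ := Bool) (Sum.inl k : Reg κ) (mk R i t c o)
    rw [update_mk_inl, mk_inl] at h1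
    have h2 := runs_clearRegs i t c o ks hnd.2 (update R k [])
    have e1 : (fun j => if j ∈ ks then [] else update R k [] j) =
        fun j => if j ∈ k :: ks then [] else R j := by
      funext j
      by_cases hj : j = k
      · subst hj; simp
      · simp [hj]
    have e2 : (ks.map fun j => 2 * (update R k [] j).length + 1) =
        ks.map fun j => 2 * (R j).length + 1 := by
      refine List.map_congr_left fun j hj => ?_
      have : j ≠ k := fun h => hnd.1 (h ▸ hj)
      rw [update_of_ne this]
    rw [e1, e2] at h2
    exact (h1.seq h2).of_eq rfl (by simp)

/-- The total size of a store. [folklore] -/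
def total (R : AStore Bool κ) : ℕ := ∑ k, (R k).length

omit [DecidableEq κ] in
/-- The cost of clearing all registers is `2 · total + |κ|`. [folklore] -/
theorem sum_clearCost (R : AStore Bool κ) :
    ((syms κ).map fun k => 2 * (R k).length + 1).sum = 2 * total R + Fintype.card κ := by
  rw [List.sum_map_add, List.sum_map_mul_left]
  simp only [List.map_const', List.sum_replicate, smul_eq_mul, mul_one]
  rw [syms, Finset.sum_map_toList, Finset.length_toList, Finset.card_univ, total]

/-- Effect and cost of `epiTail`. [folklore] -/
theorem runs_epiTail (v : Bool) (R : AStore Bool κ) :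
    Runs (epiTail v) (mk R [] [] [] []) (mk (fun _ => []) [] [] [] [v])
      (2 * total R + Fintype.card κ + 1) := by
  have h1 := runs_clearRegs (κ := κ) [] [] [] [] (syms κ) (Finset.nodup_toList _) R
  rw [sum_clearCost] at h1
  have e : (fun j => if j ∈ syms κ then [] else R j) = fun _ : κ => ([] : List Bool) := by
    funext j; simp [mem_syms j]
  rw [e] at h1
  have h2 : Runs (push (Sum.inr Aux.out : Reg κ) v) (mk (fun _ : κ => []) [] [] [] [])
      (mk (fun _ => []) [] [] [] [v]) 1 := Runs.push' (by simp)
  exact (h1.seq h2).of_eq rfl (by omega)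

/-- Popping a register does not increase the total size. [folklore] -/
theorem total_update_le (R : AStore Bool κ) (k : κ) {v : List Bool} (hv : v.length ≤ (R k).length) :
    total (update R k v) ≤ total R := by
  unfold total
  have e1 : (fun j => (update R k v j).length) = update (fun j => (R j).length) k v.length := by
    funext j; exact apply_update (fun _ (l : List Bool) => l.length) R k v j
  rw [e1, Finset.sum_update_of_mem (Finset.mem_univ k),
    Finset.sum_eq_add_sum_sdiff_singleton_of_mem (Finset.mem_univ k) fun j => (R j).length]
  omega

/-- **Effect and cost of the epilogue**: from interpreter registers `R` and clock content `c`
(other auxiliary registers empty) to the final store with output `[readout (R ans)]`, within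
`2 |c| + 2 · total R + |κ| + 5` steps. [cite: AroraBarakCC2009, Thm. 3.1 (proof)] -/
theorem runs_epi (ans : κ) (R : AStore Bool κ) (c : List Bool) :
    Runs (epi ans) (mk R [] [] c []) (mk (fun _ => []) [] [] [] [readout (R ans)])
      (2 * c.length + 2 * total R + Fintype.card κ + 5) := by
  have h1 := runs_clear (Γ := Bool) (Sum.inr Aux.clk : Reg κ) (mk R [] [] c [])
  rw [update_mk_clk, mk_clk] at h1
  unfold epi
  cases hk : R ans with
  | nil =>
    have h2 : Runs (pop (Sum.inl ans : Reg κ) fun o => epiTail (decide (o = some true)))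
        (mk R [] [] [] []) (mk (fun _ => []) [] [] [] [false]) (2 * total R + Fintype.card κ + 1 + 2) :=
      Runs.pop_nil (by simpa using hk) (by simpa using runs_epiTail (κ := κ) false R)
    exact (h1.seq h2).of_eq (by simp) (by omega)
  | cons b w =>
    have hb : decide (some b = some true) = b := by cases b <;> simp
    have htot : total (update R ans w) ≤ total R := total_update_le R ans (by rw [hk]; simp)
    have h3 := runs_epiTail (κ := κ) b (update R ans w)
    have h2 : Runs (pop (Sum.inl ans : Reg κ) fun o => epiTail (decide (o = some true)))
        (mk R [] [] [] []) (mk (fun _ => []) [] [] [] [b]) (2 * total R + Fintype.card κ + 1 + 2) :=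
      Runs.pop_cons' (f := fun o => epiTail (decide (o = some true))) (k := (Sum.inl ans : Reg κ))
        (a := b) (w := w) (R := mk R [] [] [] []) (R₀ := mk (update R ans w) [] [] [] [])
        (by simpa using hk) (by simp) (by rw [hb]; exact h3.mono (by omega))
    exact (h1.seq h2).of_eq (by simp) (by omega)

/-! ### Register growth of flat programs -/

/-- The total size after an update. [folklore] -/
theorem total_update (R : AStore Bool κ) (k : κ) (v : List Bool) :
    total (update R k v) + (R k).length = total R + v.length := by
  unfold total
  have e1 : (fun j => (update R k v j).length) = update (fun j => (R j).length) k v.length := by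
    funext j; exact apply_update (fun _ (l : List Bool) => l.length) R k v j
  rw [e1, Finset.sum_update_of_mem (Finset.mem_univ k),
    Finset.sum_eq_add_sum_sdiff_singleton_of_mem (Finset.mem_univ k) fun j => (R j).length]
  omega

/-- **A flat step writes at most one symbol.** [folklore] -/
theorem total_step_le (P : AProg Bool κ) (c : ACfg Bool κ) : total (P.step c).regs ≤ total c.regs + 1 := by
  obtain ⟨pc, R⟩ := c
  cases hins : P[pc]? with
  | none =>
    rw [AProg.step_of_le P (List.getElem?_eq_none_iff.1 hins)]
    exact Nat.le_succ _
  | some ins =>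
    rw [P.step_of_getElem? hins]
    cases ins with
    | push k a =>
      have := total_update R k (a :: R k)
      simp only [List.length_cons] at this ⊢
      omega
    | goto j => exact Nat.le_succ _
    | pop k j =>
      dsimp only
      split
      · exact Nat.le_succ _
      · next a w hk =>
        have := total_update R k w
        rw [hk] at this
        simp only [List.length_cons] at this ⊢
        omega

/-- Hence `n` flat steps write at most `n` symbols. [folklore] -/
theorem total_iterate_le (P : AProg Bool κ) (n : ℕ) (c : ACfg Bool κ) :
    total (P.step^[n] c).regs ≤ total c.regs + n := by
  induction n with
  | zero => simp
  | succ n ih =>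
    rw [Function.iterate_succ_apply']
    have := total_step_le P (P.step^[n] c)
    omega

/-- The total size of an input store. [folklore] -/
theorem total_single (X : κ) (x : List Bool) : total (AStore.single X x) = x.length := by
  have h := total_update (κ := κ) (fun _ => []) X x
  rw [← AStore.single_eq_update] at h
  have h0 : total (fun _ : κ => ([] : List Bool)) = 0 := by simp [total]
  simpa [h0] using h

/-! ### The machine -/

section Machine

variable (I : ACom Bool κ) (X ans : κ)

/-- The address of the metered interpreter. [folklore] -/
noncomputable def base : ℕ := (pre (κ := κ) X).size

/-- The exit address of the metered interpreter (completion AND time-out). [folklore] -/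
noncomputable def exitAddr : ℕ := base X + 2 * I.size

/-- **The flat program of the fuelled machine**: prelude, metered interpreter, epilogue.
[cite: AroraBarakCC2009, §1.4.1] -/
noncomputable def prog : AProg Bool (Reg κ) :=
  code (pre X) 0 ++ (FlatFuel.tick Sum.inl (.inr .clk) (base X) (exitAddr I X) (compile I) ++
    code (epi ans) (exitAddr I X))

omit [DecidableEq κ] in
/-- The length of the program. [folklore] -/
theorem length_prog : (prog I X ans).length = exitAddr I X + (epi ans).size := by
  simp [prog, exitAddr, base, Nat.add_assoc]

omit [DecidableEq κ] in
/-- The epilogue has code. [folklore] -/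
theorem epi_size_pos : 0 < (epi (κ := κ) ans).size := by
  simp [epi, size]

omit [DecidableEq κ] in
/-- The program is nonempty. [folklore] -/
theorem prog_pos : 0 < (prog I X ans).length := by
  rw [length_prog]; have := epi_size_pos (κ := κ) ans; omega

omit [DecidableEq κ] in
/-- The prelude is placed at `0`. [folklore] -/
theorem placed_pre : Placed (prog I X ans) 0 (code (pre X) 0) := placed_prefix _ _

omit [DecidableEq κ] in
/-- The whole program placed in itself, as the three segments. [folklore] -/
theorem placed_segments : Placed (prog I X ans) (0 + (code (pre X) 0).length)
    (FlatFuel.tick Sum.inl (.inr .clk) (base X) (exitAddr I X) (compile I) ++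
      code (epi ans) (exitAddr I X)) := by
  have h0 : Placed (prog I X ans) 0 (code (pre X) 0 ++
      (FlatFuel.tick Sum.inl (.inr .clk) (base X) (exitAddr I X) (compile I) ++
        code (epi ans) (exitAddr I X))) := placed_self _
  exact (placed_append.1 h0).2

omit [DecidableEq κ] in
/-- The metered interpreter is placed at `base`. [folklore] -/
theorem placed_tick : Placed (prog I X ans) (base X)
    (FlatFuel.tick Sum.inl (.inr .clk) (base X) (exitAddr I X) (compile I)) :=
  (placed_append.1 (placed_segments I X ans)).1.congr_base (by simp [base])

omit [DecidableEq κ] in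
/-- The epilogue is placed at the exit address. [folklore] -/
theorem placed_epi : Placed (prog I X ans) (exitAddr I X) (code (epi ans) (exitAddr I X)) :=
  (placed_append.1 (placed_segments I X ans)).2.congr_base (by simp [base, exitAddr])

/-- **The fuelled machine** of the interpreter `I`. [cite: AroraBarakCC2009, §1.4.1] -/
noncomputable def machine : TM2ComputableAux Bool Bool :=
  AProg.aux (prog I X ans) (prog_pos I X ans) (.inr .inp) (.inr .out)

/-- **The answer** on `x` with fuel `F`: the read-out of register `ans` after `F` steps of the
compiled interpreter from `⟨0, single X x⟩` (if the interpreter halts earlier, this is its final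
store: halted configurations are fixed). [cite: AroraBarakCC2009, §1.4.1] -/
noncomputable def sim (x : List Bool) (F : ℕ) : Bool :=
  readout (((compile I).step^[F] ⟨0, AStore.single X x⟩).regs ans)

/-- The metered phase: from the exit of the prelude, within `2F + 1` steps, the program is at the
exit address with the interpreter registers of the `F`-th iterate, some leftover fuel of length
`≤ F` on the clock, and the other auxiliary registers empty — whether the interpreter completed
(`FlatFuel.tick_complete`) or ran out of fuel (`FlatFuel.tick_exhaust`). [cite: AroraBarakCC2009, §1.4.1] -/
theorem meter_phase (x : List Bool) (F : ℕ) : ∃ t ≤ 2 * F + 1, ∃ fuel : List Bool, fuel.length ≤ F ∧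
    (prog I X ans).step^[t] ⟨base X, mk (AStore.single X x) [] [] (List.replicate F true) []⟩ =
      ⟨exitAddr I X, mk ((compile I).step^[F] ⟨0, AStore.single X x⟩).regs [] [] fuel []⟩ := by
  set P := compile I with hP
  set c₀ : ACfg Bool κ := ⟨0, AStore.single X x⟩ with hc₀
  set S : AStore Bool (Reg κ) := mk (AStore.single X x) [] [] (List.replicate F true) [] with hS
  have hS' : S = FlatFuel.tstore S Sum.inl (.inr .clk) c₀.regs (List.replicate F true) := by
    rw [tstore_eq, hS]; simp [hc₀]
  have hsat : FlatFuel.sat (base X) P.length c₀.pc = base X := by simp [FlatFuel.sat, hc₀]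
  by_cases h : ∃ m ≤ F, P.length ≤ (P.step^[m] c₀).pc
  · obtain ⟨m, hmF, hm⟩ := h
    obtain ⟨J, hJm, hin, hhalt, hJeq⟩ := FlatFuel.exists_haltTime P c₀ m hm
    have key := FlatFuel.tick_complete Sum.inl_injective (fun _ => Sum.inl_ne_inr) P (prog I X ans)
      (base X) (exitAddr I X) (placed_tick I X ans) S c₀ J F hin hhalt (hJm.trans hmF)
    rw [hsat, ← hS'] at key
    have hfix : P.step^[F] c₀ = P.step^[J] c₀ := by
      obtain ⟨d, rfl⟩ := Nat.exists_eq_add_of_le (hJm.trans hmF)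
      rw [Nat.add_comm, Function.iterate_add_apply, AProg.iterate_step_of_le P hhalt]
    refine ⟨2 * J, by omega, List.replicate (F - J) true, by simp, ?_⟩
    rw [key, hfix, tstore_eq]
    simp [hS, exitAddr, hP]
  · push Not at h
    have key := FlatFuel.tick_exhaust Sum.inl_injective (fun _ => Sum.inl_ne_inr) P (prog I X ans)
      (base X) (exitAddr I X) (placed_tick I X ans) S c₀ F (fun m hm => h m hm)
    rw [hsat, ← hS'] at key
    refine ⟨2 * F + 1, le_rfl, [], by simp, ?_⟩
    rw [key, tstore_eq]
    simp [hS]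

/-- **The run of the fuelled machine.** On every input `⟨x, 1^F⟩` the flat program reaches its
end, with the single output `[sim x F]`, within `(|κ| + 13)(|x| + F) + (|κ| + 13)` steps.
[cite: AroraBarakCC2009, §1.4.1] -/
theorem run (x : List Bool) (F : ℕ) :
    ∃ t ≤ (Fintype.card κ + 13) * (x.length + F) + (Fintype.card κ + 13),
      (prog I X ans).step^[t] ⟨0, AStore.single (.inr .inp) (boolPair x (List.replicate F true))⟩ =
        ⟨(prog I X ans).length, AStore.single (.inr .out) [sim I X ans x F]⟩ := by
  -- prelude
  obtain ⟨t₁, ht₁, e₁⟩ := runs_pre (κ := κ) X x F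
  have E₁ := e₁.iterate_step (placed_pre I X ans)
  rw [Nat.zero_add] at E₁
  -- metered interpreter
  obtain ⟨t₂, ht₂, fuel, hfuel, E₂⟩ := meter_phase I X ans x F
  -- epilogue
  obtain ⟨t₃, ht₃, e₃⟩ := runs_epi (κ := κ) ans ((compile I).step^[F] ⟨0, AStore.single X x⟩).regs fuel
  have E₃ := e₃.iterate_step (placed_epi I X ans)
  have htot : total ((compile I).step^[F] ⟨0, AStore.single X x⟩).regs ≤ x.length + F := by
    have := total_iterate_le (compile I) F ⟨0, AStore.single X x⟩
    simp only [total_single] at this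
    exact this
  refine ⟨t₃ + t₂ + t₁, ?_, ?_⟩
  · have hk : 10 ≤ Fintype.card κ + 13 := by omega
    nlinarith
  · rw [Function.iterate_add_apply, Function.iterate_add_apply, E₁, show (pre X).size = base X from rfl,
      E₂, E₃, length_prog, single_out]
    rfl

/-- **Linear time on every input.** [cite: AroraBarakCC2009, §1.4.1] -/
theorem outputsWithin_machine (x : List Bool) (F : ℕ) :
    (machine I X ans).OutputsWithin (boolPair x (List.replicate F true)) (encodeBool (sim I X ans x F))
      ((Fintype.card κ + 13) * (x.length + F) + (Fintype.card κ + 13)) := by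
  obtain ⟨t, ht, e⟩ := run I X ans x F
  have henc : encodeBool (sim I X ans x F) = [sim I X ans x F] := by
    cases sim I X ans x F <;> rfl
  rw [henc]
  exact (AProg.outputsWithin_of_iterate (prog I X ans) (prog_pos I X ans) (.inr .inp) (.inr .out) e
    le_rfl).mono ht

omit [Fintype κ] in
/-- **The answer of a completed run.** If the interpreter runs from `single X x` to `R'` within a
budget of at most `F`, the fuelled answer is `readout (R' ans)`. [cite: AroraBarakCC2009, §1.4.1] -/
theorem sim_eq_of_runs {x : List Bool} {F B : ℕ} {R' : AStore Bool κ}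
    (h : Runs I (AStore.single X x) R' B) (hB : B ≤ F) : sim I X ans x F = readout (R' ans) := by
  obtain ⟨t, ht, e⟩ := h
  have h1 := e.compile_iterate
  have h2 : (compile I).step^[F] ⟨0, AStore.single X x⟩ = ⟨I.size, R'⟩ :=
    iterate_of_reached (by simp) h1 (ht.trans hB)
  rw [sim, h2]

end Machine

/-! ### The fuelled universal decider of an interpreter -/

/-- **Correct interpreters.** `Interprets I X ans`: for every machine `M` there are a header `e`
and a constant `κ₀` such that for every padding `pad`, if `M` halts on `x = ⟨e, pad⟩` with output
`[b]` within `t` steps, then `I`, started with `x` on `X`, reaches within budget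
`κ₀ (t + |x|)² + κ₀` a store whose register `ans` reads `¬ b` (Arora–Barak 2009, Thm. 1.9 in the
relaxed `C T²` form, with the answer flipped as in the proof of Thm. 3.1). [cite: AroraBarakCC2009, Thm. 1.9 and Thm. 3.1 (proof)] -/
def Interprets (I : ACom Bool κ) (X ans : κ) : Prop :=
  ∀ M : TM2ComputableAux Bool Bool, ∃ (e : List Bool) (κ₀ : ℕ),
    ∀ (pad : List Bool) (b : Bool) (t : ℕ),
      M.OutputsWithin (boolPair e pad) (encodeBool b) t →
      ∃ R' : AStore Bool κ, Runs I (AStore.single X (boolPair e pad)) R'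
        (κ₀ * (t + (boolPair e pad).length) ^ 2 + κ₀) ∧ readout (R' ans) = !b

/-- **The fuelled universal decider of a correct interpreter.** [cite: AroraBarakCC2009, Thm. 1.9 and §1.4.1] -/
noncomputable def fuelledSimulator (I : ACom Bool κ) (X ans : κ) (hI : Interprets I X ans) :
    FuelledSimulator where
  sim := sim I X ans
  machine := machine I X ans
  a := Fintype.card κ + 13
  outputsWithin := outputsWithin_machine I X ans
  universal M := by
    obtain ⟨e, κ₀, h⟩ := hI M
    refine ⟨e, κ₀, fun pad b t F hM hF => ?_⟩
    obtain ⟨R', hR, hread⟩ := h pad b t hM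
    rw [sim_eq_of_runs I X ans hR hF, hread]

/-- **The time hierarchy theorem from a correct interpreter.** [cite: HartmanisStearns1965, Thm. 9 / Cor. 9.1] -/
theorem time_hierarchy_of_interpreter (I : ACom Bool κ) (X ans : κ) (hI : Interprets I X ans) :
    time_hierarchy :=
  time_hierarchy_of_fuelledSimulator (fuelledSimulator I X ans hI)

end FuelledRun

end Literature.Computability.Complexity
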